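import Summits.QuantumFields.YangMills.Theorems.CovariantDischargeThresholdRatio
import Literature.MathematicalPhysics.QuantumFieldTheory.Balaban1983to89.T3SmallLiftHistory
import HarnessLib

/-!
# Line «sandwich_discharge» on crux `HistoryTailL` (stmt-QuantumFields-19936), stub `stub_sandwichSweepGapCapped` (S′), brick B4 —
# «THE FAR-MEAN THRESHOLD LETTER»: `θ(Λb)(K−h) ≤ Λ·(√L⁻¹)^{−(h−j)}… ` — precisely `θ(Λ·b)(K−h) ≤ Λ·θ(b)(K−j) ∕ (√L⁻¹)^{h−j}` written without division:
# `(√L⁻¹)^{h−j}·θ(Λb)(K−h) ≤ Λ·θ(b)(K−j)` for `j ≤ h ≤ K`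

Cell `ym3-torus` (YM ladder rung R3 = continuum SU(2) Yang–Mills on the three-torus — a RUNG, NOT the Clay problem); width seat `ym3-torus-px8` gen 7;
`--supports stmt-QuantumFields-19936` (helper).  THEOREMS ONLY (0 `def`, default heartbeats).

WHY (px8 g6 ARCH-S′ §5 = ARCH-S′ v2 (R3), the one line called B4).  The matched far plaquette `P″` at height `h = j + m` enters the signal with weight
`L^{−2m}` through the COARSER conjunct `dist1 Ū^h(∂P″) < θ(Λb)(K−h)`; to compare with the signal `θ := θ(b)(K−j)` one needs the threshold at the COARSER
height in terms of the finer one: `g_{K−h} = (√L⁻¹)^{−(h−j)}·g_{K−j}`-type algebra (px6 g8 ✓`CovariantDischargeThresholdRatio.coupling_eq_sqrt_inv_pow_mul`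
at `(K−j, h−j)`), `p(·)` DECREASING in the coupling (lit ✓`T3SmallLiftHistory.pFun_le_pFun_of_le`), and linearity in the profile constant
(`θ_{Λb} = Λ·θ_b`, two-line `ring` identity as in ✓`FirstExitWindowOneStepWindowL.θBal_const_mul`, inlined to keep the imports light).  So `(√L⁻¹)^{h−j}·θ(Λb)(K−h) ≤ Λ·θ(b)(K−j)`, i.e. `L^{−2m}·θ(Λb)(K−h) ≤ Λ·L^{−3m∕2}·θ(b)(K−j)` — B4's `θ∕(8√L)` once
`L^{3m∕2} ≥ 8√L·Λ` (the definition of `m_Λ`).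
* `coupling_sub_eq` — `g_{K−h} = … `: `√(γL^{−(K−j)}) = (√L⁻¹)^{h−j}·√(γL^{−(K−h)})` (`j ≤ h ≤ K`);
* ★ `sqrt_inv_pow_mul_θBal_le` — `(√L⁻¹)^{h−j}·θ(b)(K−h) ≤ θ(b)(K−j)` (`0 < γ ≤ 1`, `1 ≤ L`, `0 ≤ b`, `0 ≤ p₀`);
* ★★ `sqrt_inv_pow_mul_θBal_mul_le` — with the severity factor: `(√L⁻¹)^{h−j}·θ(Λ·b)(K−h) ≤ Λ·θ(b)(K−j)` (`0 ≤ Λ`); `inv_pow_mul_θBal_mul_sq_le` — squared form `(L^{h−j})⁻¹θ(Λb)(K−h)² ≤ Λ²θ(b)(K−j)²`.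
HONEST SCOPE: threshold algebra; nothing of B6, the capped stub, `HistoryTailL` or any summit statement; YM₃ on T³ is rung R3, not Clay. [cite: Balaban1985UV3, (3) p.256 and (7) p.257]
-/

noncomputable section

namespace Summit.QuantumFields.YangMills.Theorems.CovariantDischargeFarMeanThreshold

open Literature.MathematicalPhysics.QuantumFieldTheory.Balaban1983to89
open Literature.MathematicalPhysics.QuantumFieldTheory.Balaban1983to89.T3UnitScaleTilt (θBal)
open Literature.MathematicalPhysics.QuantumFieldTheory.Balaban1983to89.T3Thresholds (θBal_eq coupling_le_one)
open Literature.MathematicalPhysics.QuantumFieldTheory.Balaban1983to89.T3ThresholdSmallness (sqrt_coupling_pos_le)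
open Literature.MathematicalPhysics.QuantumFieldTheory.Balaban1983to89.T3SmallLiftHistory (pFun_le_pFun_of_le)
open Summit.QuantumFields.YangMills.Theorems.CovariantDischargeThresholdRatio (coupling_eq_sqrt_inv_pow_mul)

variable {L : ℕ} {γ b₀ p₀ : ℝ}

/-- `g_{K−j} = (√L⁻¹)^{h−j}·g_{K−h}` for `j ≤ h ≤ K` (✓`coupling_eq_sqrt_inv_pow_mul` at `(K−j, h−j)`). [cite: Balaban1985UV3, (3) p.256] -/
theorem coupling_sub_eq (L : ℕ) (γ : ℝ) {K j h : ℕ} (hjh : j ≤ h) (hhK : h ≤ K) :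
    Real.sqrt (γ * ((L : ℝ)⁻¹) ^ (K - j)) = Real.sqrt ((L : ℝ)⁻¹) ^ (h - j) * Real.sqrt (γ * ((L : ℝ)⁻¹) ^ (K - h)) := by
  have h1 := coupling_eq_sqrt_inv_pow_mul L γ (K := K - j) (j := h - j) (by omega)
  rwa [show K - j - (h - j) = K - h by omega] at h1

/-- ★ **THE COARSER THRESHOLD AGAINST THE FINER ONE**: `(√L⁻¹)^{h−j}·θ(b)(K−h) ≤ θ(b)(K−j)` — the coupling scales exactly and `p(·)` only decreases when
the coupling grows. [cite: Balaban1985UV3, (7) p.257] -/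
theorem sqrt_inv_pow_mul_θBal_le (hL : 1 ≤ L) (hγ : 0 < γ) (hγ1 : γ ≤ 1) (hb : 0 ≤ b₀) (hp : 0 ≤ p₀) {K j h : ℕ} (hjh : j ≤ h) (hhK : h ≤ K) :
    Real.sqrt ((L : ℝ)⁻¹) ^ (h - j) * θBal L γ b₀ p₀ (K - h) ≤ θBal L γ b₀ p₀ (K - j) := by
  rw [θBal_eq, θBal_eq, coupling_sub_eq L γ hjh hhK, ← mul_assoc]
  have hg := sqrt_coupling_pos_le hL hγ (K - h)
  have hg1 := coupling_le_one hL hγ hγ1 (K - h)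
  have hL' : (0 : ℝ) < L := by exact_mod_cast hL
  have hs : 0 < Real.sqrt ((L : ℝ)⁻¹) ^ (h - j) := pow_pos (Real.sqrt_pos.mpr (inv_pos.mpr hL')) _
  have hs1 : Real.sqrt ((L : ℝ)⁻¹) ^ (h - j) ≤ 1 := by
    refine pow_le_one₀ (Real.sqrt_nonneg _) ?_
    rw [Real.sqrt_le_one]
    exact inv_le_one_of_one_le₀ (by exact_mod_cast hL)
  have hprod : 0 < Real.sqrt ((L : ℝ)⁻¹) ^ (h - j) * Real.sqrt (γ * ((L : ℝ)⁻¹) ^ (K - h)) := mul_pos hs hg.1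
  have hle : Real.sqrt ((L : ℝ)⁻¹) ^ (h - j) * Real.sqrt (γ * ((L : ℝ)⁻¹) ^ (K - h)) ≤ Real.sqrt (γ * ((L : ℝ)⁻¹) ^ (K - h)) :=
    mul_le_of_le_one_left hg.1.le hs1
  -- `p` decreases as the coupling grows
  have hp' := pFun_le_pFun_of_le hb hp hprod hle hg1
  exact mul_le_mul_of_nonneg_left hp' hprod.le

/-- ★★ **WITH THE SEVERITY FACTOR**: `(√L⁻¹)^{h−j}·θ(Λ·b)(K−h) ≤ Λ·θ(b)(K−j)` (`0 ≤ Λ`) — the COARSER conjunct's threshold at the matched far plaquette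
against the signal threshold; with the dipole weight `L^{−2m}` (`m = h − j`) this is B4's far-mean bound `≤ Λ·L^{−3m∕2}·θ`. [cite: Balaban1985UV3, (7) p.257] -/
theorem sqrt_inv_pow_mul_θBal_mul_le (hL : 1 ≤ L) (hγ : 0 < γ) (hγ1 : γ ≤ 1) (hb : 0 ≤ b₀) (hp : 0 ≤ p₀) {Λ : ℝ} (hΛ : 0 ≤ Λ) {K j h : ℕ}
    (hjh : j ≤ h) (hhK : h ≤ K) :
    Real.sqrt ((L : ℝ)⁻¹) ^ (h - j) * θBal L γ (Λ * b₀) p₀ (K - h) ≤ Λ * θBal L γ b₀ p₀ (K - j) := by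
  have hcm : θBal L γ (Λ * b₀) p₀ (K - h) = Λ * θBal L γ b₀ p₀ (K - h) := by
    rw [θBal_eq, θBal_eq]
    unfold B10.pFun
    ring
  rw [hcm, mul_left_comm]
  exact mul_le_mul_of_nonneg_left (sqrt_inv_pow_mul_θBal_le hL hγ hγ1 hb hp hjh hhK) hΛ

/-- The same with powers of `L` instead of `√L⁻¹`: `θ(Λb)(K−h)·… ` — `((√L⁻¹)^{h−j})² = (L^{h−j})⁻¹`, so squaring-free consumers can use
`(L^{h−j})⁻¹·θ(Λb)(K−h)² ≤ Λ²·θ(b)(K−j)²`. [cite: Balaban1985UV3, (7) p.257] -/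
theorem inv_pow_mul_θBal_mul_sq_le (hL : 1 ≤ L) (hγ : 0 < γ) (hγ1 : γ ≤ 1) (hb : 0 ≤ b₀) (hp : 0 ≤ p₀) {Λ : ℝ} (hΛ : 0 ≤ Λ) {K j h : ℕ}
    (hjh : j ≤ h) (hhK : h ≤ K) :
    ((L : ℝ) ^ (h - j))⁻¹ * θBal L γ (Λ * b₀) p₀ (K - h) ^ 2 ≤ Λ ^ 2 * θBal L γ b₀ p₀ (K - j) ^ 2 := by
  have hmain := sqrt_inv_pow_mul_θBal_mul_le hL hγ hγ1 hb hp hΛ hjh hhK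
  have h0 : 0 ≤ Real.sqrt ((L : ℝ)⁻¹) ^ (h - j) * θBal L γ (Λ * b₀) p₀ (K - h) := by
    refine mul_nonneg (pow_nonneg (Real.sqrt_nonneg _) _) ?_
    have hcm : θBal L γ (Λ * b₀) p₀ (K - h) = Λ * θBal L γ b₀ p₀ (K - h) := by
      rw [θBal_eq, θBal_eq]
      unfold B10.pFun
      ring
    rw [hcm]
    refine mul_nonneg hΛ ?_
    rw [θBal_eq]
    have hg := sqrt_coupling_pos_le hL hγ (K - h)
    exact mul_nonneg hg.1.le (B10.pFun_nonneg b₀ p₀ _ hb hg.1 (coupling_le_one hL hγ hγ1 _))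
  have hsq := pow_le_pow_left₀ h0 hmain 2
  have hs2 : (Real.sqrt ((L : ℝ)⁻¹) ^ (h - j)) ^ 2 = ((L : ℝ) ^ (h - j))⁻¹ := by
    rw [← pow_mul, mul_comm, pow_mul, Real.sq_sqrt (inv_nonneg.mpr (Nat.cast_nonneg L)), inv_pow]
  rw [mul_pow, hs2, mul_pow] at hsq
  exact hsq

end Summit.QuantumFields.YangMills.Theorems.CovariantDischargeFarMeanThreshold

end
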